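import Summits.QuantumFields.YangMills.Theorems.BalabanUVNodesN11O3OfIntrinsicReadingAtRecord13

/-!
# DAG node N11 — `SupplierObligations θ p σ` (dag-n11-e's «what [III] §3 must deliver») FROM THE SUPPLIER's OWN TERM DATA, THE NEW-TERM BOUNDS, AND THE
# CONDITIONAL-EXPECTATION IDENTITIES — at `rePinH θ` nothing else: N11's chain-road residual as a list of chart-free obligations on a §3 supplier

HEADER — WORK-UNIT METADATA.  Cell `pub-ymgap`, YM-PLAN Track A (HUMAN RULING D-0062), seat `pub-ymgap-dag-n11-d` (g16; R134 fan-out base seat N11 [B14], strategy s2),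
route `BalabanUVNodes`, item K1⁹ `StabilityBRunRowsAtRecordR13SepCoPHV` = stmt-QuantumFields-27364 (helper lane, `--kind proof --supports 27364 --as helper`, count-neutral).
[III] = [Balaban1988Convergent], [IV] = [Balaban1989LargeFieldI].  Sequel of this seat's `…N11O3OfIntrinsicReadingAtRecord13` (§2: the (O3′) clause of the witness chain from
the supplier's term rows and ONE a.e. identity per old branch, generic `θ` and `rePinH θ`) over dag-n11-e's `…Sect3SupplyChainObligationsDefs` (`SupplierObligations`,
`SupplyChainAt`, `sLaw₁₃CoPH_all_of_obligations`) and dag-n11-w3's `…Sect3SupplyChainTermRows` (`SupplierTermRows`).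

WHY THIS FILE.  N11's one-token residual on the chain road is `SupplyChainAt θ p = ∃ σ, SupplierObligations θ p σ ∧ NoExpansionObligation θ p σ`; the second conjunct is the
-d lane's no-expansion series (discharged from rows: `noExpansionObligation_of_residualRows_of_operandRows`, `…_of_gaussCert_…`), the first is «what [III] §3 must deliver»:
(loc) locality, (univE) ∕ (newE) the 𝐄-clauses, and (present) `PresentChildObligations` at every 𝐓-present child = (O1′)+(O2) new-term BOUNDS + (O3′) the 𝐓-image identity.
After this seat's g14–g16 the (O3′) conjunct is ONE a.e. identity per old branch between def-T's skew conditional expectation of the old graph piece and 11a's intrinsic new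
integrand (hce₀).  THIS FILE assembles: `SupplierObligations θ p σ` ⟸ the supplier's own term data (loc ∕ univE ∕ newE ∕ `SupplierTermRows`) + the new-term bounds (O1′)+(O2)
at every present child + the conditional-expectation identities at every present child and old branch (+, at a generic `θ`, measurability of the residual's `ζ0 ∕ quad` at
every history; at `rePinH θ` NOTHING else).  So a §3 supplier's ENTIRE debt to Theorem 1's induction, beyond bounds on its own terms, is the family (hce) — [I] §2's change of
variables + Jacobian + gauge fixing + `ζ` + [III] Thm 2's re-expansion, as identities of conditional expectations, with no chart, no per-bond data, no support clause.

WHAT THIS FILE PROVES (0 `def`, 0 `sorry`, standard axioms).  ★★★ `supplierObligations_of_bounds_of_condExp` (generic `θ`: core provisos + residual-measurability rows) ·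
★★★ `supplierObligations_rePinH_of_bounds_of_condExp` (at `rePinH θ`: core provisos of `θ` only) · ★★★ `supplyChainAt_of_bounds_of_condExp_of_residualRows` (N11's ONE-TOKEN
RESIDUAL `SupplyChainAt θ p` from the same + `ZhUnity`, `1 ≤ M` and dag-n11-e's witness-free `ResidualRows θ p`; Theorem 1 ∕ Theorem p. 245 at `θ` then BY NAME).

HONEST FRAMING.  Helper lane of K1⁹; count-neutral; two structure constructors BY NAME over the prequel; (hbounds) and (hce) DISPLAYED — they are [III] Thm 2 (bounds and the
re-expansion identity) and [I] §2, NOT proved here; no supplier is constructed; `NoExpansionObligation` is not touched here; (B4) ∕ (S-α) ∕ (O3′) NOT closed; N11 NOT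
discharged; K1⁹ NOT closed, no registered stub touched; counts unmoved (typed 28∕28 · discharged 5∕27 · A 5∕28).  One finite `𝕋⁴_{L^K}` programme at fixed `ε = L^{−K}`; R4
closes only the conditional finite-𝕋⁴ rung `BalabanLadder.UV` — NOT ℝ⁴, NOT OS, NOT a mass gap, NOT Clay.  No `sorry`, `axiom`, `def`, `instance`, `notation`.  Sources (SHAPE ∕
bookkeeping only): [III] Thm 1 p.262, Thm 2 p.263, §3 p.279, (2.27)–(2.31) pp.259–260, (2.38)–(2.42) p.261, (3.1) p.264, (3.23)–(3.25) p.270; [IV] (0.2)–(0.3) p.176.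
-/

noncomputable section

open MeasureTheory ProbabilityTheory
open scoped ENNReal NNReal BigOperators Matrix.Norms.L2Operator

namespace Summit.QuantumFields.YangMills.Theorems.BalabanUVNodesN11SupplierObligationsOfCondExp

open Literature.MathematicalPhysics.QuantumFieldTheory.Balaban1983to89
open Literature.MathematicalPhysics.QuantumFieldTheory.Balaban1983to89.T4AveragingDisintegration
open BalabanUVNodesN11O3OfIntrinsicReadingAtRecord13 (O3_presentChild_of_chainFormAt_of_supplierTermRows_of_condExp O3_presentChild_rePinH_of_chainFormAt_of_supplierTermRows_of_condExp)
open BalabanUVNodesN11RePinnedParamDefs (rePinH)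
open BalabanUVNodesN11FluctTruncationDefs (IsFluctLocal)
open BalabanUVNodesN11Sect3SupplyChainDefs (PresentChildObligations Sect3Supplier chainWitness NewEClausesAt)
open BalabanUVNodesN11Sect3SupplyChainObligationsDefs (ChainFormAt SupplierObligations SupplyChainAt ResidualRows noExpansionObligation_of_residualRows_of_operandRows)
open BalabanUVNodesN11Sect3SupplyChainTermRows (SupplierTermRows operandRowsAlongChain_of_supplierTermRows)
open BalabanUVNodesN11Sect3SupplySpliceOwnBoundary (graftAboveB)
open Node00 hiding SU
open Node00.Tk T4Continuum B14.Eq218Concrete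
open B10Eq42TorusConstraint (bondsIn)

variable {F : T4Family} {N : ℕ} [NeZero N]

/-- ★★★ **`SupplierObligations θ p σ` FROM THE SUPPLIER's TERM DATA, THE NEW-TERM BOUNDS, AND THE CONDITIONAL-EXPECTATION IDENTITIES** (generic `θ` with the core
provisos and measurable residual rows at every history): (loc) ∕ (univE) ∕ (newE) verbatim; (present) assembled per 𝐓-present child from (hbounds) and the prequel's
`O3_presentChild_of_chainFormAt_of_supplierTermRows_of_condExp` fed with (hce). [cite: Balaban1988Convergent, Thm 1 p.262, Thm 2 p.263, §3 p.279, (3.23)–(3.25) p.270, (2.27)–(2.31) pp.259–260, (2.38)–(2.42) p.261] -/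
theorem supplierObligations_of_bounds_of_condExp (θ : Stage13HParams F N) (h : θ.Provisos₁₃CoPH F N) (p : B12.RunParams)
    (σ : Sect3Supplier θ p)
    -- the supplier's own data: locality (2.40)–(2.41), universality in 𝐄, the level-`(k+1)` 𝐄-clauses, the term rows of its constructed terms
    (hloc : ∀ k (s : SeqOfRecord F θ.ν θ.τ9.M (gOfRecord₁₃ F N θ.toStage13Params p) p.K (k + 1)), IsFluctLocal (k + 1) ((σ k (chainWitness θ p σ k).1 (chainWitness θ p σ k).2).1 s))
    (hunivE : ∀ k, k < p.K → ChainFormAt θ p σ k → Sect2.UniversalE (σ k (chainWitness θ p σ k).1 (chainWitness θ p σ k).2).1)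
    (hnewE : ∀ k, k < p.K → ChainFormAt θ p σ k →
      ∀ s : SeqOfRecord F θ.ν θ.τ9.M (gOfRecord₁₃ F N θ.toStage13Params p) p.K (k + 1), NewEClausesAt θ p k ((σ k (chainWitness θ p σ k).1 (chainWitness θ p σ k).2).1 s) s)
    (hσ : SupplierTermRows θ p σ)
    -- measurability of the residual's `ζ0_j(Y)` ∕ `quad_j(Λ′)` at every history (dag-n11-e's `ResidualRowsAt` shape)
    (hζm : ∀ n (s : SeqOfRecord F θ.ν θ.τ9.M (gOfRecord₁₃ F N θ.toStage13Params p) p.K n) j Y, Measurable ((θ.zhAt p s).ζ0 j Y))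
    (hqm : ∀ n (s : SeqOfRecord F θ.ν θ.τ9.M (gOfRecord₁₃ F N θ.toStage13Params p) p.K n) j Λ', Measurable ((θ.zhAt p s).quad j Λ'))
    -- THE NEW-TERM BOUNDS (O1′) + (O2) of [III] Thm 2 at every 𝐓-present child, for the supplier's response (displayed)
    (hbounds : ∀ k (hkK : k < p.K), ChainFormAt θ p σ k →
      ∀ s' : SeqOfRecord F θ.ν θ.τ9.M (gOfRecord₁₃ F N θ.toStage13Params p) p.K (k + 1), s'.Ω (k + 1) ≠ ∅ →
      slotsTOfRecord F N θ.ν θ.τ9 (EOfRecord₁₃ F N θ.toStage13Params) (wOfRecord₉ F N θ.toStage9Params) θ.ppSel p (gOfRecord₁₃ F N θ.toStage13Params p) (k + 1) s' ≠ 0 →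
      (1 ≤ k →
        (∀ (X : (Sect2.domSys (F.P p.K) θ.τ9.M k).Dom) (φ : Sect2.CPair (F.P p.K) (MatA N)) (a : SFluct (F.P p.K) (FluctV N)),
          φ ∈ (sect2TowerOfRecord F N (FluctV N) p.K (settingOfRecord₁₃ F N θ.toStage13Params p) (θ.rzAt p s') s' ((σ k (chainWitness θ p σ k).1 (chainWitness θ p σ k).2).1 s')).spaceB k X →
            ‖((σ k (chainWitness θ p σ k).1 (chainWitness θ p σ k).2).1 s').B k X φ a‖ ≤ (settingOfRecord₁₃ F N θ.toStage13Params p).lf.B₀ * Real.exp (-(settingOfRecord₁₃ F N θ.toStage13Params p).lf.κ * (Sect2.domSys (F.P p.K) θ.τ9.M k).dj X)) ∧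
        (∀ (X : (Sect2.domSys (F.P p.K) θ.τ9.M k).Dom) (a : SFluct (F.P p.K) (FluctV N)),
          AnalyticOnNhd ℂ (fun φ => ((σ k (chainWitness θ p σ k).1 (chainWitness θ p σ k).2).1 s').B k X φ a) ((sect2TowerOfRecord F N (FluctV N) p.K (settingOfRecord₁₃ F N θ.toStage13Params p) (θ.rzAt p s') s' ((σ k (chainWitness θ p σ k).1 (chainWitness θ p σ k).2).1 s')).spaceB k X))) ∧
      Step.LFNewTerms (sect2TowerOfRecord F N (FluctV N) p.K (settingOfRecord₁₃ F N θ.toStage13Params p) (θ.rzAt p s') s' ((σ k (chainWitness θ p σ k).1 (chainWitness θ p σ k).2).1 s')) (settingOfRecord₁₃ F N θ.toStage13Params p).lf (settingOfRecord₁₃ F N θ.toStage13Params p).βc k ∧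
      (∀ (X : (Sect2.domSys (F.P p.K) θ.τ9.M (k + 1)).Dom) (z : Site (F.P p.K) (k + 1)) (g : ℝ), 0 ≤ g → g ≤ (settingOfRecord₁₃ F N θ.toStage13Params p).lf.γ →
        AnalyticOnNhd ℂ (((σ k (chainWitness θ p σ k).1 (chainWitness θ p σ k).2).1 s').E (k + 1) X z g)
          ((sect2TowerOfRecord F N (FluctV N) p.K (settingOfRecord₁₃ F N θ.toStage13Params p) (θ.rzAt p s') s' ((σ k (chainWitness θ p σ k).1 (chainWitness θ p σ k).2).1 s')).space (k + 1) X ((settingOfRecord₁₃ F N θ.toStage13Params p).lf.alpha0 ((settingOfRecord₁₃ F N θ.toStage13Params p).flow.g (k + 1))) ((settingOfRecord₁₃ F N θ.toStage13Params p).lf.alpha1 ((settingOfRecord₁₃ F N θ.toStage13Params p).flow.g (k + 1))))) ∧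
      (∀ X : (Sect2.domSys (F.P p.K) θ.τ9.M (k + 1)).Dom,
        AnalyticOnNhd ℂ (((σ k (chainWitness θ p σ k).1 (chainWitness θ p σ k).2).1 s').R (k + 1) X)
          ((sect2TowerOfRecord F N (FluctV N) p.K (settingOfRecord₁₃ F N θ.toStage13Params p) (θ.rzAt p s') s' ((σ k (chainWitness θ p σ k).1 (chainWitness θ p σ k).2).1 s')).space (k + 1) X ((settingOfRecord₁₃ F N θ.toStage13Params p).lf.alpha0 ((settingOfRecord₁₃ F N θ.toStage13Params p).flow.g (k + 1))) ((settingOfRecord₁₃ F N θ.toStage13Params p).lf.alpha1 ((settingOfRecord₁₃ F N θ.toStage13Params p).flow.g (k + 1))))) ∧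
      (∀ (X : (Sect2.domSys (F.P p.K) θ.τ9.M (k + 1)).Dom) (a : SFluct (F.P p.K) (FluctV N)),
        AnalyticOnNhd ℂ (fun φ => ((σ k (chainWitness θ p σ k).1 (chainWitness θ p σ k).2).1 s').B (k + 1) X φ a) ((sect2TowerOfRecord F N (FluctV N) p.K (settingOfRecord₁₃ F N θ.toStage13Params p) (θ.rzAt p s') s' ((σ k (chainWitness θ p σ k).1 (chainWitness θ p σ k).2).1 s')).spaceB (k + 1) X)))
    -- THE CONDITIONAL-EXPECTATION IDENTITIES: per level `k < K` with Theorem 1's inductive hypothesis, per 𝐓-present child `s′` with `𝐓ρ_k(s′) ≢ 0`, per old branch `S₀`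
    (hce : ∀ k (hkK : k < p.K), ChainFormAt θ p σ k →
      ∀ s' : SeqOfRecord F θ.ν θ.τ9.M (gOfRecord₁₃ F N θ.toStage13Params p) p.K (k + 1), s'.Ω (k + 1) ≠ ∅ →
      slotsTOfRecord F N θ.ν θ.τ9 (EOfRecord₁₃ F N θ.toStage13Params) (wOfRecord₉ F N θ.toStage9Params) θ.ppSel p (gOfRecord₁₃ F N θ.toStage13Params p) (k + 1) s' ≠ 0 →
      ∀ S₀ ∈ admSOfRecord F θ.ν θ.τ9.M (gOfRecord₁₃ F N θ.toStage13Params p) p.K k s'.init, kernelTransport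
        ((Measure.pi fun _ : ↥(Set.toFinite (bondsIn k (s'.Ω (k + 1))ᶜ)).toFinset => (HaarData.haar : Measure (SU N))).prod
          (Measure.pi fun _ : {b : PBond (F.P p.K) k // b ∉ (Set.toFinite (bondsIn k (s'.Ω (k + 1))ᶜ)).toFinset} => (HaarData.haar : Measure (SU N))))
        ((Measure.pi fun _ : ↥(Set.toFinite (bondsIn k (s'.Ω (k + 1))ᶜ)).toFinset => (HaarData.haar : Measure (SU N))).prod
          (Measure.pi fun _ : {c : PBond (F.P p.K) (k + 1) // c ∉ (Set.toFinite (bondsIn (k + 1) (s'.Ω (k + 1))ᶜ)).toFinset} =>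
            (HaarData.haar : Measure (SU N))))
        (fun q => (q.1, fun c : {c : PBond (F.P p.K) (k + 1) // c ∉ (Set.toFinite (bondsIn (k + 1) (s'.Ω (k + 1))ᶜ)).toFinset} =>
          (avOfRecord F N p.K k).avg
            ((MeasurableEquiv.piEquivPiSubtypeProd (fun _ : PBond (F.P p.K) k => SU N)
              (· ∈ (Set.toFinite (bondsIn k (s'.Ω (k + 1))ᶜ)).toFinset)).symm q) c))
        ((fun U => wOfRecord₉ F N θ.toStage9Params p (gOfRecord₁₃ F N θ.toStage13Params p) k s' U ((avOfRecord F N p.K k).avg U) *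
            (chiSeqOfRecord F N θ.ν θ.τ9.M (gOfRecord₁₃ F N θ.toStage13Params p) p.K k s'.init U *
              tkBranchOfRecord F N (FluctV N) θ.ν θ.τ9.M (gOfRecord₁₃ F N θ.toStage13Params p) p.K (WtOfRecord₁₃H F N θ p s'.init) s'.init S₀ k
                (fun ω => (sect2Operand F N (FluctV N) p.K (settingOfRecord₁₃ F N θ.toStage13Params p) (θ.rzAt p s'.init) s'.init ((chainWitness θ p σ k).1 s'.init) ((chainWitness θ p σ k).2 s'.init)
            (UbgOfRecord₁₃CoP F N θ.toStage13Params p k s'.init)) (S₀, fun j => (ω j).2) (fun j => (ω j).1)) (baseCfg k U))) ∘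
          ⇑(MeasurableEquiv.piEquivPiSubtypeProd (fun _ : PBond (F.P p.K) k => SU N)
            (· ∈ (Set.toFinite (bondsIn k (s'.Ω (k + 1))ᶜ)).toFinset)).symm)
      =ᵐ[((Measure.pi fun _ : ↥(Set.toFinite (bondsIn k (s'.Ω (k + 1))ᶜ)).toFinset => (HaarData.haar : Measure (SU N))).prod
          (Measure.pi fun _ : {c : PBond (F.P p.K) (k + 1) // c ∉ (Set.toFinite (bondsIn (k + 1) (s'.Ω (k + 1))ᶜ)).toFinset} =>
            (HaarData.haar : Measure (SU N))))]
        fun z => ∑ Y ∈ (Set.toFinite {Y : Set (Site (F.P p.K) 0) | Y ∈ SClassOfRecord F θ.ν (gOfRecord₁₃ F N θ.toStage13Params p) p.K (k + 1) ∧ Y ⊆ s'.Ω (k + 1) ∩ (s'.Λ (k + 1))ᶜ}).toFinset,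
          zetaOp (genDataOfRecord F N (FluctV N) θ.ν θ.τ9.M (gOfRecord₁₃ F N θ.toStage13Params p) p.K (WtOfRecord₁₃H F N θ p s') s' (Function.update S₀ (k + 1) Y) k).ζ
            (aOp k (genDataOfRecord F N (FluctV N) θ.ν θ.τ9.M (gOfRecord₁₃ F N θ.toStage13Params p) p.K (WtOfRecord₁₃H F N θ p s') s' (Function.update S₀ (k + 1) Y) k).sA
              (genDataOfRecord F N (FluctV N) θ.ν θ.τ9.M (gOfRecord₁₃ F N θ.toStage13Params p) p.K (WtOfRecord₁₃H F N θ p s') s' (Function.update S₀ (k + 1) Y) k).w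
              (tkBranchOfRecord F N (FluctV N) θ.ν θ.τ9.M (gOfRecord₁₃ F N θ.toStage13Params p) p.K (WtOfRecord₁₃H F N θ p s') s'.init S₀ k
                (fun ω => (sect2Operand F N (FluctV N) p.K (settingOfRecord₁₃ F N θ.toStage13Params p) (θ.rzAt p s') s' (graftAboveB k ((chainWitness θ p σ k).1 s'.init) ((σ k (chainWitness θ p σ k).1 (chainWitness θ p σ k).2).1 s')) ((σ k (chainWitness θ p σ k).1 (chainWitness θ p σ k).2).2 s')
                  (UbgOfRecord₁₃CoP F N θ.toStage13Params p (k + 1) s')) (Function.update S₀ (k + 1) Y, fun j => (ω j).2) (fun j => (ω j).1))))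
            (Function.update (baseCfg (k + 1) ((MeasurableEquiv.piEquivPiSubtypeProd (fun _ : PBond (F.P p.K) (k + 1) => SU N)
              (· ∈ (Set.toFinite (bondsIn (k + 1) (s'.Ω (k + 1))ᶜ)).toFinset)).symm (avgRestrOfRecord F N p.K k (Set.toFinite (bondsIn k (s'.Ω (k + 1))ᶜ)).toFinset
                (Set.toFinite (bondsIn (k + 1) (s'.Ω (k + 1))ᶜ)).toFinset z.1, z.2))) k
            (Function.updateFinset ((baseCfg (V := FluctV N) (k + 1) ((MeasurableEquiv.piEquivPiSubtypeProd (fun _ : PBond (F.P p.K) (k + 1) => SU N)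
              (· ∈ (Set.toFinite (bondsIn (k + 1) (s'.Ω (k + 1))ᶜ)).toFinset)).symm (avgRestrOfRecord F N p.K k (Set.toFinite (bondsIn k (s'.Ω (k + 1))ᶜ)).toFinset
                (Set.toFinite (bondsIn (k + 1) (s'.Ω (k + 1))ᶜ)).toFinset z.1, z.2))) k).1 (Set.toFinite (bondsIn k (s'.Ω (k + 1))ᶜ)).toFinset z.1,
              ((baseCfg (V := FluctV N) (k + 1) ((MeasurableEquiv.piEquivPiSubtypeProd (fun _ : PBond (F.P p.K) (k + 1) => SU N)
              (· ∈ (Set.toFinite (bondsIn (k + 1) (s'.Ω (k + 1))ᶜ)).toFinset)).symm (avgRestrOfRecord F N p.K k (Set.toFinite (bondsIn k (s'.Ω (k + 1))ᶜ)).toFinset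
                (Set.toFinite (bondsIn (k + 1) (s'.Ω (k + 1))ᶜ)).toFinset z.1, z.2))) k).2))) :
    SupplierObligations θ p σ where
  loc := hloc
  univE := hunivE
  newE := hnewE
  present k hkK hform s' hΩ hT :=
    have hb := hbounds k hkK hform s' hΩ hT
    ⟨hb.1, hb.2.1, hb.2.2.1, hb.2.2.2.1, hb.2.2.2.2,
      O3_presentChild_of_chainFormAt_of_supplierTermRows_of_condExp θ h p hkK (show k + 1 ≤ (F.P p.K).m + (F.P p.K).K from by show k + 1 ≤ F.m + p.K; omega)
        σ hform hσ s' (hζm _ _) (hqm _ _) (hζm _ _) (hqm _ _) (hce k hkK hform s' hΩ hT)⟩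

/-- ★★★ **`SupplierObligations (rePinH θ) p σ` FROM THE SUPPLIER's TERM DATA, THE NEW-TERM BOUNDS, AND THE CONDITIONAL-EXPECTATION IDENTITIES — NOTHING ELSE but the core
provisos of `θ`** (at the re-pinned parameter the residual rows are theorems; the prequel's `O3_presentChild_rePinH_of_chainFormAt_of_supplierTermRows_of_condExp`).
[cite: Balaban1988Convergent, Thm 1 p.262, Thm 2 p.263, §3 p.279, (3.23)–(3.25) p.270, (2.27)–(2.31) pp.259–260, (2.38)–(2.42) p.261; Balaban1989LargeFieldI, (0.2)–(0.3) p.176] -/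
theorem supplierObligations_rePinH_of_bounds_of_condExp (θ : Stage13HParams F N) (h : θ.Provisos₁₃CoPH F N) (p : B12.RunParams)
    (σ : Sect3Supplier (rePinH θ) p)
    -- the supplier's own data: locality (2.40)–(2.41), universality in 𝐄, the level-`(k+1)` 𝐄-clauses, the term rows of its constructed terms
    (hloc : ∀ k (s : SeqOfRecord F (rePinH θ).ν (rePinH θ).τ9.M (gOfRecord₁₃ F N (rePinH θ).toStage13Params p) p.K (k + 1)), IsFluctLocal (k + 1) ((σ k (chainWitness (rePinH θ) p σ k).1 (chainWitness (rePinH θ) p σ k).2).1 s))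
    (hunivE : ∀ k, k < p.K → ChainFormAt (rePinH θ) p σ k → Sect2.UniversalE (σ k (chainWitness (rePinH θ) p σ k).1 (chainWitness (rePinH θ) p σ k).2).1)
    (hnewE : ∀ k, k < p.K → ChainFormAt (rePinH θ) p σ k →
      ∀ s : SeqOfRecord F (rePinH θ).ν (rePinH θ).τ9.M (gOfRecord₁₃ F N (rePinH θ).toStage13Params p) p.K (k + 1), NewEClausesAt (rePinH θ) p k ((σ k (chainWitness (rePinH θ) p σ k).1 (chainWitness (rePinH θ) p σ k).2).1 s) s)
    (hσ : SupplierTermRows (rePinH θ) p σ)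
    -- THE NEW-TERM BOUNDS (O1′) + (O2) of [III] Thm 2 at every 𝐓-present child, for the supplier's response (displayed)
    (hbounds : ∀ k (hkK : k < p.K), ChainFormAt (rePinH θ) p σ k →
      ∀ s' : SeqOfRecord F (rePinH θ).ν (rePinH θ).τ9.M (gOfRecord₁₃ F N (rePinH θ).toStage13Params p) p.K (k + 1), s'.Ω (k + 1) ≠ ∅ →
      slotsTOfRecord F N (rePinH θ).ν (rePinH θ).τ9 (EOfRecord₁₃ F N (rePinH θ).toStage13Params) (wOfRecord₉ F N (rePinH θ).toStage9Params) (rePinH θ).ppSel p (gOfRecord₁₃ F N (rePinH θ).toStage13Params p) (k + 1) s' ≠ 0 →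
      (1 ≤ k →
        (∀ (X : (Sect2.domSys (F.P p.K) (rePinH θ).τ9.M k).Dom) (φ : Sect2.CPair (F.P p.K) (MatA N)) (a : SFluct (F.P p.K) (FluctV N)),
          φ ∈ (sect2TowerOfRecord F N (FluctV N) p.K (settingOfRecord₁₃ F N (rePinH θ).toStage13Params p) ((rePinH θ).rzAt p s') s' ((σ k (chainWitness (rePinH θ) p σ k).1 (chainWitness (rePinH θ) p σ k).2).1 s')).spaceB k X →
            ‖((σ k (chainWitness (rePinH θ) p σ k).1 (chainWitness (rePinH θ) p σ k).2).1 s').B k X φ a‖ ≤ (settingOfRecord₁₃ F N (rePinH θ).toStage13Params p).lf.B₀ * Real.exp (-(settingOfRecord₁₃ F N (rePinH θ).toStage13Params p).lf.κ * (Sect2.domSys (F.P p.K) (rePinH θ).τ9.M k).dj X)) ∧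
        (∀ (X : (Sect2.domSys (F.P p.K) (rePinH θ).τ9.M k).Dom) (a : SFluct (F.P p.K) (FluctV N)),
          AnalyticOnNhd ℂ (fun φ => ((σ k (chainWitness (rePinH θ) p σ k).1 (chainWitness (rePinH θ) p σ k).2).1 s').B k X φ a) ((sect2TowerOfRecord F N (FluctV N) p.K (settingOfRecord₁₃ F N (rePinH θ).toStage13Params p) ((rePinH θ).rzAt p s') s' ((σ k (chainWitness (rePinH θ) p σ k).1 (chainWitness (rePinH θ) p σ k).2).1 s')).spaceB k X))) ∧
      Step.LFNewTerms (sect2TowerOfRecord F N (FluctV N) p.K (settingOfRecord₁₃ F N (rePinH θ).toStage13Params p) ((rePinH θ).rzAt p s') s' ((σ k (chainWitness (rePinH θ) p σ k).1 (chainWitness (rePinH θ) p σ k).2).1 s')) (settingOfRecord₁₃ F N (rePinH θ).toStage13Params p).lf (settingOfRecord₁₃ F N (rePinH θ).toStage13Params p).βc k ∧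
      (∀ (X : (Sect2.domSys (F.P p.K) (rePinH θ).τ9.M (k + 1)).Dom) (z : Site (F.P p.K) (k + 1)) (g : ℝ), 0 ≤ g → g ≤ (settingOfRecord₁₃ F N (rePinH θ).toStage13Params p).lf.γ →
        AnalyticOnNhd ℂ (((σ k (chainWitness (rePinH θ) p σ k).1 (chainWitness (rePinH θ) p σ k).2).1 s').E (k + 1) X z g)
          ((sect2TowerOfRecord F N (FluctV N) p.K (settingOfRecord₁₃ F N (rePinH θ).toStage13Params p) ((rePinH θ).rzAt p s') s' ((σ k (chainWitness (rePinH θ) p σ k).1 (chainWitness (rePinH θ) p σ k).2).1 s')).space (k + 1) X ((settingOfRecord₁₃ F N (rePinH θ).toStage13Params p).lf.alpha0 ((settingOfRecord₁₃ F N (rePinH θ).toStage13Params p).flow.g (k + 1))) ((settingOfRecord₁₃ F N (rePinH θ).toStage13Params p).lf.alpha1 ((settingOfRecord₁₃ F N (rePinH θ).toStage13Params p).flow.g (k + 1))))) ∧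
      (∀ X : (Sect2.domSys (F.P p.K) (rePinH θ).τ9.M (k + 1)).Dom,
        AnalyticOnNhd ℂ (((σ k (chainWitness (rePinH θ) p σ k).1 (chainWitness (rePinH θ) p σ k).2).1 s').R (k + 1) X)
          ((sect2TowerOfRecord F N (FluctV N) p.K (settingOfRecord₁₃ F N (rePinH θ).toStage13Params p) ((rePinH θ).rzAt p s') s' ((σ k (chainWitness (rePinH θ) p σ k).1 (chainWitness (rePinH θ) p σ k).2).1 s')).space (k + 1) X ((settingOfRecord₁₃ F N (rePinH θ).toStage13Params p).lf.alpha0 ((settingOfRecord₁₃ F N (rePinH θ).toStage13Params p).flow.g (k + 1))) ((settingOfRecord₁₃ F N (rePinH θ).toStage13Params p).lf.alpha1 ((settingOfRecord₁₃ F N (rePinH θ).toStage13Params p).flow.g (k + 1))))) ∧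
      (∀ (X : (Sect2.domSys (F.P p.K) (rePinH θ).τ9.M (k + 1)).Dom) (a : SFluct (F.P p.K) (FluctV N)),
        AnalyticOnNhd ℂ (fun φ => ((σ k (chainWitness (rePinH θ) p σ k).1 (chainWitness (rePinH θ) p σ k).2).1 s').B (k + 1) X φ a) ((sect2TowerOfRecord F N (FluctV N) p.K (settingOfRecord₁₃ F N (rePinH θ).toStage13Params p) ((rePinH θ).rzAt p s') s' ((σ k (chainWitness (rePinH θ) p σ k).1 (chainWitness (rePinH θ) p σ k).2).1 s')).spaceB (k + 1) X)))
    -- THE CONDITIONAL-EXPECTATION IDENTITIES: per level `k < K` with Theorem 1's inductive hypothesis, per 𝐓-present child `s′` with `𝐓ρ_k(s′) ≢ 0`, per old branch `S₀`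
    (hce : ∀ k (hkK : k < p.K), ChainFormAt (rePinH θ) p σ k →
      ∀ s' : SeqOfRecord F (rePinH θ).ν (rePinH θ).τ9.M (gOfRecord₁₃ F N (rePinH θ).toStage13Params p) p.K (k + 1), s'.Ω (k + 1) ≠ ∅ →
      slotsTOfRecord F N (rePinH θ).ν (rePinH θ).τ9 (EOfRecord₁₃ F N (rePinH θ).toStage13Params) (wOfRecord₉ F N (rePinH θ).toStage9Params) (rePinH θ).ppSel p (gOfRecord₁₃ F N (rePinH θ).toStage13Params p) (k + 1) s' ≠ 0 →
      ∀ S₀ ∈ admSOfRecord F (rePinH θ).ν (rePinH θ).τ9.M (gOfRecord₁₃ F N (rePinH θ).toStage13Params p) p.K k s'.init, kernelTransport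
        ((Measure.pi fun _ : ↥(Set.toFinite (bondsIn k (s'.Ω (k + 1))ᶜ)).toFinset => (HaarData.haar : Measure (SU N))).prod
          (Measure.pi fun _ : {b : PBond (F.P p.K) k // b ∉ (Set.toFinite (bondsIn k (s'.Ω (k + 1))ᶜ)).toFinset} => (HaarData.haar : Measure (SU N))))
        ((Measure.pi fun _ : ↥(Set.toFinite (bondsIn k (s'.Ω (k + 1))ᶜ)).toFinset => (HaarData.haar : Measure (SU N))).prod
          (Measure.pi fun _ : {c : PBond (F.P p.K) (k + 1) // c ∉ (Set.toFinite (bondsIn (k + 1) (s'.Ω (k + 1))ᶜ)).toFinset} =>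
            (HaarData.haar : Measure (SU N))))
        (fun q => (q.1, fun c : {c : PBond (F.P p.K) (k + 1) // c ∉ (Set.toFinite (bondsIn (k + 1) (s'.Ω (k + 1))ᶜ)).toFinset} =>
          (avOfRecord F N p.K k).avg
            ((MeasurableEquiv.piEquivPiSubtypeProd (fun _ : PBond (F.P p.K) k => SU N)
              (· ∈ (Set.toFinite (bondsIn k (s'.Ω (k + 1))ᶜ)).toFinset)).symm q) c))
        ((fun U => wOfRecord₉ F N (rePinH θ).toStage9Params p (gOfRecord₁₃ F N (rePinH θ).toStage13Params p) k s' U ((avOfRecord F N p.K k).avg U) *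
            (chiSeqOfRecord F N (rePinH θ).ν (rePinH θ).τ9.M (gOfRecord₁₃ F N (rePinH θ).toStage13Params p) p.K k s'.init U *
              tkBranchOfRecord F N (FluctV N) (rePinH θ).ν (rePinH θ).τ9.M (gOfRecord₁₃ F N (rePinH θ).toStage13Params p) p.K (WtOfRecord₁₃H F N (rePinH θ) p s'.init) s'.init S₀ k
                (fun ω => (sect2Operand F N (FluctV N) p.K (settingOfRecord₁₃ F N (rePinH θ).toStage13Params p) ((rePinH θ).rzAt p s'.init) s'.init ((chainWitness (rePinH θ) p σ k).1 s'.init) ((chainWitness (rePinH θ) p σ k).2 s'.init)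
            (UbgOfRecord₁₃CoP F N (rePinH θ).toStage13Params p k s'.init)) (S₀, fun j => (ω j).2) (fun j => (ω j).1)) (baseCfg k U))) ∘
          ⇑(MeasurableEquiv.piEquivPiSubtypeProd (fun _ : PBond (F.P p.K) k => SU N)
            (· ∈ (Set.toFinite (bondsIn k (s'.Ω (k + 1))ᶜ)).toFinset)).symm)
      =ᵐ[((Measure.pi fun _ : ↥(Set.toFinite (bondsIn k (s'.Ω (k + 1))ᶜ)).toFinset => (HaarData.haar : Measure (SU N))).prod
          (Measure.pi fun _ : {c : PBond (F.P p.K) (k + 1) // c ∉ (Set.toFinite (bondsIn (k + 1) (s'.Ω (k + 1))ᶜ)).toFinset} =>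
            (HaarData.haar : Measure (SU N))))]
        fun z => ∑ Y ∈ (Set.toFinite {Y : Set (Site (F.P p.K) 0) | Y ∈ SClassOfRecord F (rePinH θ).ν (gOfRecord₁₃ F N (rePinH θ).toStage13Params p) p.K (k + 1) ∧ Y ⊆ s'.Ω (k + 1) ∩ (s'.Λ (k + 1))ᶜ}).toFinset,
          zetaOp (genDataOfRecord F N (FluctV N) (rePinH θ).ν (rePinH θ).τ9.M (gOfRecord₁₃ F N (rePinH θ).toStage13Params p) p.K (WtOfRecord₁₃H F N (rePinH θ) p s') s' (Function.update S₀ (k + 1) Y) k).ζ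
            (aOp k (genDataOfRecord F N (FluctV N) (rePinH θ).ν (rePinH θ).τ9.M (gOfRecord₁₃ F N (rePinH θ).toStage13Params p) p.K (WtOfRecord₁₃H F N (rePinH θ) p s') s' (Function.update S₀ (k + 1) Y) k).sA
              (genDataOfRecord F N (FluctV N) (rePinH θ).ν (rePinH θ).τ9.M (gOfRecord₁₃ F N (rePinH θ).toStage13Params p) p.K (WtOfRecord₁₃H F N (rePinH θ) p s') s' (Function.update S₀ (k + 1) Y) k).w
              (tkBranchOfRecord F N (FluctV N) (rePinH θ).ν (rePinH θ).τ9.M (gOfRecord₁₃ F N (rePinH θ).toStage13Params p) p.K (WtOfRecord₁₃H F N (rePinH θ) p s') s'.init S₀ k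
                (fun ω => (sect2Operand F N (FluctV N) p.K (settingOfRecord₁₃ F N (rePinH θ).toStage13Params p) ((rePinH θ).rzAt p s') s' (graftAboveB k ((chainWitness (rePinH θ) p σ k).1 s'.init) ((σ k (chainWitness (rePinH θ) p σ k).1 (chainWitness (rePinH θ) p σ k).2).1 s')) ((σ k (chainWitness (rePinH θ) p σ k).1 (chainWitness (rePinH θ) p σ k).2).2 s')
                  (UbgOfRecord₁₃CoP F N (rePinH θ).toStage13Params p (k + 1) s')) (Function.update S₀ (k + 1) Y, fun j => (ω j).2) (fun j => (ω j).1))))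
            (Function.update (baseCfg (k + 1) ((MeasurableEquiv.piEquivPiSubtypeProd (fun _ : PBond (F.P p.K) (k + 1) => SU N)
              (· ∈ (Set.toFinite (bondsIn (k + 1) (s'.Ω (k + 1))ᶜ)).toFinset)).symm (avgRestrOfRecord F N p.K k (Set.toFinite (bondsIn k (s'.Ω (k + 1))ᶜ)).toFinset
                (Set.toFinite (bondsIn (k + 1) (s'.Ω (k + 1))ᶜ)).toFinset z.1, z.2))) k
            (Function.updateFinset ((baseCfg (V := FluctV N) (k + 1) ((MeasurableEquiv.piEquivPiSubtypeProd (fun _ : PBond (F.P p.K) (k + 1) => SU N)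
              (· ∈ (Set.toFinite (bondsIn (k + 1) (s'.Ω (k + 1))ᶜ)).toFinset)).symm (avgRestrOfRecord F N p.K k (Set.toFinite (bondsIn k (s'.Ω (k + 1))ᶜ)).toFinset
                (Set.toFinite (bondsIn (k + 1) (s'.Ω (k + 1))ᶜ)).toFinset z.1, z.2))) k).1 (Set.toFinite (bondsIn k (s'.Ω (k + 1))ᶜ)).toFinset z.1,
              ((baseCfg (V := FluctV N) (k + 1) ((MeasurableEquiv.piEquivPiSubtypeProd (fun _ : PBond (F.P p.K) (k + 1) => SU N)
              (· ∈ (Set.toFinite (bondsIn (k + 1) (s'.Ω (k + 1))ᶜ)).toFinset)).symm (avgRestrOfRecord F N p.K k (Set.toFinite (bondsIn k (s'.Ω (k + 1))ᶜ)).toFinset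
                (Set.toFinite (bondsIn (k + 1) (s'.Ω (k + 1))ᶜ)).toFinset z.1, z.2))) k).2))) :
    SupplierObligations (rePinH θ) p σ where
  loc := hloc
  univE := hunivE
  newE := hnewE
  present k hkK hform s' hΩ hT :=
    have hb := hbounds k hkK hform s' hΩ hT
    ⟨hb.1, hb.2.1, hb.2.2.1, hb.2.2.2.1, hb.2.2.2.2,
      O3_presentChild_rePinH_of_chainFormAt_of_supplierTermRows_of_condExp θ h p hkK (show k + 1 ≤ (F.P p.K).m + (F.P p.K).K from by show k + 1 ≤ F.m + p.K; omega)
        σ hform hσ s' (hce k hkK hform s' hΩ hT)⟩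

/-- ★★★ **N11's ONE-TOKEN RESIDUAL `SupplyChainAt θ p` FROM THE SUPPLIER's TERM DATA, THE NEW-TERM BOUNDS, THE CONDITIONAL-EXPECTATION IDENTITIES AND THE WITNESS-FREE
RESIDUAL ROWS** (generic `θ`: core provisos, `ZhUnity`, `1 ≤ M`): §1 gives `SupplierObligations θ p σ`; dag-n11-e's `noExpansionObligation_of_residualRows_of_operandRows` gives
`NoExpansionObligation θ p σ` from (loc), `ResidualRows θ p` and the operand rows along the chain (dag-n11-w3's `operandRowsAlongChain_of_supplierTermRows`).  From the token,
Theorem 1 ∕ the Theorem of p. 245 at `θ` follow BY NAME (`sLaw₁₃CoPH_all_of_supplyChainAt`, `thmP245Laws_of_supplyChainAt`, on the live-selector line).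
[cite: Balaban1988Convergent, Thm 1 p.262, Theorem p.245, Thm 2 p.263, §3 p.279, (3.23)–(3.25) p.270; Balaban1989LargeFieldI, (0.2)–(0.4) p.176] -/
theorem supplyChainAt_of_bounds_of_condExp_of_residualRows (θ : Stage13HParams F N) (h : θ.Provisos₁₃CoPH F N) (hU : θ.ZhUnity F N) (hM : 1 ≤ θ.τ9.M)
    (p : B12.RunParams) (hres : ResidualRows θ p)
    (σ : Sect3Supplier θ p)
    -- the supplier's own data: locality (2.40)–(2.41), universality in 𝐄, the level-`(k+1)` 𝐄-clauses, the term rows of its constructed terms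
    (hloc : ∀ k (s : SeqOfRecord F θ.ν θ.τ9.M (gOfRecord₁₃ F N θ.toStage13Params p) p.K (k + 1)), IsFluctLocal (k + 1) ((σ k (chainWitness θ p σ k).1 (chainWitness θ p σ k).2).1 s))
    (hunivE : ∀ k, k < p.K → ChainFormAt θ p σ k → Sect2.UniversalE (σ k (chainWitness θ p σ k).1 (chainWitness θ p σ k).2).1)
    (hnewE : ∀ k, k < p.K → ChainFormAt θ p σ k →
      ∀ s : SeqOfRecord F θ.ν θ.τ9.M (gOfRecord₁₃ F N θ.toStage13Params p) p.K (k + 1), NewEClausesAt θ p k ((σ k (chainWitness θ p σ k).1 (chainWitness θ p σ k).2).1 s) s)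
    (hσ : SupplierTermRows θ p σ)
    -- measurability of the residual's `ζ0_j(Y)` ∕ `quad_j(Λ′)` at every history (dag-n11-e's `ResidualRowsAt` shape)
    (hζm : ∀ n (s : SeqOfRecord F θ.ν θ.τ9.M (gOfRecord₁₃ F N θ.toStage13Params p) p.K n) j Y, Measurable ((θ.zhAt p s).ζ0 j Y))
    (hqm : ∀ n (s : SeqOfRecord F θ.ν θ.τ9.M (gOfRecord₁₃ F N θ.toStage13Params p) p.K n) j Λ', Measurable ((θ.zhAt p s).quad j Λ'))
    -- THE NEW-TERM BOUNDS (O1′) + (O2) of [III] Thm 2 at every 𝐓-present child, for the supplier's response (displayed)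
    (hbounds : ∀ k (hkK : k < p.K), ChainFormAt θ p σ k →
      ∀ s' : SeqOfRecord F θ.ν θ.τ9.M (gOfRecord₁₃ F N θ.toStage13Params p) p.K (k + 1), s'.Ω (k + 1) ≠ ∅ →
      slotsTOfRecord F N θ.ν θ.τ9 (EOfRecord₁₃ F N θ.toStage13Params) (wOfRecord₉ F N θ.toStage9Params) θ.ppSel p (gOfRecord₁₃ F N θ.toStage13Params p) (k + 1) s' ≠ 0 →
      (1 ≤ k →
        (∀ (X : (Sect2.domSys (F.P p.K) θ.τ9.M k).Dom) (φ : Sect2.CPair (F.P p.K) (MatA N)) (a : SFluct (F.P p.K) (FluctV N)),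
          φ ∈ (sect2TowerOfRecord F N (FluctV N) p.K (settingOfRecord₁₃ F N θ.toStage13Params p) (θ.rzAt p s') s' ((σ k (chainWitness θ p σ k).1 (chainWitness θ p σ k).2).1 s')).spaceB k X →
            ‖((σ k (chainWitness θ p σ k).1 (chainWitness θ p σ k).2).1 s').B k X φ a‖ ≤ (settingOfRecord₁₃ F N θ.toStage13Params p).lf.B₀ * Real.exp (-(settingOfRecord₁₃ F N θ.toStage13Params p).lf.κ * (Sect2.domSys (F.P p.K) θ.τ9.M k).dj X)) ∧
        (∀ (X : (Sect2.domSys (F.P p.K) θ.τ9.M k).Dom) (a : SFluct (F.P p.K) (FluctV N)),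
          AnalyticOnNhd ℂ (fun φ => ((σ k (chainWitness θ p σ k).1 (chainWitness θ p σ k).2).1 s').B k X φ a) ((sect2TowerOfRecord F N (FluctV N) p.K (settingOfRecord₁₃ F N θ.toStage13Params p) (θ.rzAt p s') s' ((σ k (chainWitness θ p σ k).1 (chainWitness θ p σ k).2).1 s')).spaceB k X))) ∧
      Step.LFNewTerms (sect2TowerOfRecord F N (FluctV N) p.K (settingOfRecord₁₃ F N θ.toStage13Params p) (θ.rzAt p s') s' ((σ k (chainWitness θ p σ k).1 (chainWitness θ p σ k).2).1 s')) (settingOfRecord₁₃ F N θ.toStage13Params p).lf (settingOfRecord₁₃ F N θ.toStage13Params p).βc k ∧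
      (∀ (X : (Sect2.domSys (F.P p.K) θ.τ9.M (k + 1)).Dom) (z : Site (F.P p.K) (k + 1)) (g : ℝ), 0 ≤ g → g ≤ (settingOfRecord₁₃ F N θ.toStage13Params p).lf.γ →
        AnalyticOnNhd ℂ (((σ k (chainWitness θ p σ k).1 (chainWitness θ p σ k).2).1 s').E (k + 1) X z g)
          ((sect2TowerOfRecord F N (FluctV N) p.K (settingOfRecord₁₃ F N θ.toStage13Params p) (θ.rzAt p s') s' ((σ k (chainWitness θ p σ k).1 (chainWitness θ p σ k).2).1 s')).space (k + 1) X ((settingOfRecord₁₃ F N θ.toStage13Params p).lf.alpha0 ((settingOfRecord₁₃ F N θ.toStage13Params p).flow.g (k + 1))) ((settingOfRecord₁₃ F N θ.toStage13Params p).lf.alpha1 ((settingOfRecord₁₃ F N θ.toStage13Params p).flow.g (k + 1))))) ∧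
      (∀ X : (Sect2.domSys (F.P p.K) θ.τ9.M (k + 1)).Dom,
        AnalyticOnNhd ℂ (((σ k (chainWitness θ p σ k).1 (chainWitness θ p σ k).2).1 s').R (k + 1) X)
          ((sect2TowerOfRecord F N (FluctV N) p.K (settingOfRecord₁₃ F N θ.toStage13Params p) (θ.rzAt p s') s' ((σ k (chainWitness θ p σ k).1 (chainWitness θ p σ k).2).1 s')).space (k + 1) X ((settingOfRecord₁₃ F N θ.toStage13Params p).lf.alpha0 ((settingOfRecord₁₃ F N θ.toStage13Params p).flow.g (k + 1))) ((settingOfRecord₁₃ F N θ.toStage13Params p).lf.alpha1 ((settingOfRecord₁₃ F N θ.toStage13Params p).flow.g (k + 1))))) ∧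
      (∀ (X : (Sect2.domSys (F.P p.K) θ.τ9.M (k + 1)).Dom) (a : SFluct (F.P p.K) (FluctV N)),
        AnalyticOnNhd ℂ (fun φ => ((σ k (chainWitness θ p σ k).1 (chainWitness θ p σ k).2).1 s').B (k + 1) X φ a) ((sect2TowerOfRecord F N (FluctV N) p.K (settingOfRecord₁₃ F N θ.toStage13Params p) (θ.rzAt p s') s' ((σ k (chainWitness θ p σ k).1 (chainWitness θ p σ k).2).1 s')).spaceB (k + 1) X)))
    -- THE CONDITIONAL-EXPECTATION IDENTITIES: per level `k < K` with Theorem 1's inductive hypothesis, per 𝐓-present child `s′` with `𝐓ρ_k(s′) ≢ 0`, per old branch `S₀`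
    (hce : ∀ k (hkK : k < p.K), ChainFormAt θ p σ k →
      ∀ s' : SeqOfRecord F θ.ν θ.τ9.M (gOfRecord₁₃ F N θ.toStage13Params p) p.K (k + 1), s'.Ω (k + 1) ≠ ∅ →
      slotsTOfRecord F N θ.ν θ.τ9 (EOfRecord₁₃ F N θ.toStage13Params) (wOfRecord₉ F N θ.toStage9Params) θ.ppSel p (gOfRecord₁₃ F N θ.toStage13Params p) (k + 1) s' ≠ 0 →
      ∀ S₀ ∈ admSOfRecord F θ.ν θ.τ9.M (gOfRecord₁₃ F N θ.toStage13Params p) p.K k s'.init, kernelTransport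
        ((Measure.pi fun _ : ↥(Set.toFinite (bondsIn k (s'.Ω (k + 1))ᶜ)).toFinset => (HaarData.haar : Measure (SU N))).prod
          (Measure.pi fun _ : {b : PBond (F.P p.K) k // b ∉ (Set.toFinite (bondsIn k (s'.Ω (k + 1))ᶜ)).toFinset} => (HaarData.haar : Measure (SU N))))
        ((Measure.pi fun _ : ↥(Set.toFinite (bondsIn k (s'.Ω (k + 1))ᶜ)).toFinset => (HaarData.haar : Measure (SU N))).prod
          (Measure.pi fun _ : {c : PBond (F.P p.K) (k + 1) // c ∉ (Set.toFinite (bondsIn (k + 1) (s'.Ω (k + 1))ᶜ)).toFinset} =>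
            (HaarData.haar : Measure (SU N))))
        (fun q => (q.1, fun c : {c : PBond (F.P p.K) (k + 1) // c ∉ (Set.toFinite (bondsIn (k + 1) (s'.Ω (k + 1))ᶜ)).toFinset} =>
          (avOfRecord F N p.K k).avg
            ((MeasurableEquiv.piEquivPiSubtypeProd (fun _ : PBond (F.P p.K) k => SU N)
              (· ∈ (Set.toFinite (bondsIn k (s'.Ω (k + 1))ᶜ)).toFinset)).symm q) c))
        ((fun U => wOfRecord₉ F N θ.toStage9Params p (gOfRecord₁₃ F N θ.toStage13Params p) k s' U ((avOfRecord F N p.K k).avg U) *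
            (chiSeqOfRecord F N θ.ν θ.τ9.M (gOfRecord₁₃ F N θ.toStage13Params p) p.K k s'.init U *
              tkBranchOfRecord F N (FluctV N) θ.ν θ.τ9.M (gOfRecord₁₃ F N θ.toStage13Params p) p.K (WtOfRecord₁₃H F N θ p s'.init) s'.init S₀ k
                (fun ω => (sect2Operand F N (FluctV N) p.K (settingOfRecord₁₃ F N θ.toStage13Params p) (θ.rzAt p s'.init) s'.init ((chainWitness θ p σ k).1 s'.init) ((chainWitness θ p σ k).2 s'.init)
            (UbgOfRecord₁₃CoP F N θ.toStage13Params p k s'.init)) (S₀, fun j => (ω j).2) (fun j => (ω j).1)) (baseCfg k U))) ∘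
          ⇑(MeasurableEquiv.piEquivPiSubtypeProd (fun _ : PBond (F.P p.K) k => SU N)
            (· ∈ (Set.toFinite (bondsIn k (s'.Ω (k + 1))ᶜ)).toFinset)).symm)
      =ᵐ[((Measure.pi fun _ : ↥(Set.toFinite (bondsIn k (s'.Ω (k + 1))ᶜ)).toFinset => (HaarData.haar : Measure (SU N))).prod
          (Measure.pi fun _ : {c : PBond (F.P p.K) (k + 1) // c ∉ (Set.toFinite (bondsIn (k + 1) (s'.Ω (k + 1))ᶜ)).toFinset} =>
            (HaarData.haar : Measure (SU N))))]
        fun z => ∑ Y ∈ (Set.toFinite {Y : Set (Site (F.P p.K) 0) | Y ∈ SClassOfRecord F θ.ν (gOfRecord₁₃ F N θ.toStage13Params p) p.K (k + 1) ∧ Y ⊆ s'.Ω (k + 1) ∩ (s'.Λ (k + 1))ᶜ}).toFinset,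
          zetaOp (genDataOfRecord F N (FluctV N) θ.ν θ.τ9.M (gOfRecord₁₃ F N θ.toStage13Params p) p.K (WtOfRecord₁₃H F N θ p s') s' (Function.update S₀ (k + 1) Y) k).ζ
            (aOp k (genDataOfRecord F N (FluctV N) θ.ν θ.τ9.M (gOfRecord₁₃ F N θ.toStage13Params p) p.K (WtOfRecord₁₃H F N θ p s') s' (Function.update S₀ (k + 1) Y) k).sA
              (genDataOfRecord F N (FluctV N) θ.ν θ.τ9.M (gOfRecord₁₃ F N θ.toStage13Params p) p.K (WtOfRecord₁₃H F N θ p s') s' (Function.update S₀ (k + 1) Y) k).w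
              (tkBranchOfRecord F N (FluctV N) θ.ν θ.τ9.M (gOfRecord₁₃ F N θ.toStage13Params p) p.K (WtOfRecord₁₃H F N θ p s') s'.init S₀ k
                (fun ω => (sect2Operand F N (FluctV N) p.K (settingOfRecord₁₃ F N θ.toStage13Params p) (θ.rzAt p s') s' (graftAboveB k ((chainWitness θ p σ k).1 s'.init) ((σ k (chainWitness θ p σ k).1 (chainWitness θ p σ k).2).1 s')) ((σ k (chainWitness θ p σ k).1 (chainWitness θ p σ k).2).2 s')
                  (UbgOfRecord₁₃CoP F N θ.toStage13Params p (k + 1) s')) (Function.update S₀ (k + 1) Y, fun j => (ω j).2) (fun j => (ω j).1))))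
            (Function.update (baseCfg (k + 1) ((MeasurableEquiv.piEquivPiSubtypeProd (fun _ : PBond (F.P p.K) (k + 1) => SU N)
              (· ∈ (Set.toFinite (bondsIn (k + 1) (s'.Ω (k + 1))ᶜ)).toFinset)).symm (avgRestrOfRecord F N p.K k (Set.toFinite (bondsIn k (s'.Ω (k + 1))ᶜ)).toFinset
                (Set.toFinite (bondsIn (k + 1) (s'.Ω (k + 1))ᶜ)).toFinset z.1, z.2))) k
            (Function.updateFinset ((baseCfg (V := FluctV N) (k + 1) ((MeasurableEquiv.piEquivPiSubtypeProd (fun _ : PBond (F.P p.K) (k + 1) => SU N)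
              (· ∈ (Set.toFinite (bondsIn (k + 1) (s'.Ω (k + 1))ᶜ)).toFinset)).symm (avgRestrOfRecord F N p.K k (Set.toFinite (bondsIn k (s'.Ω (k + 1))ᶜ)).toFinset
                (Set.toFinite (bondsIn (k + 1) (s'.Ω (k + 1))ᶜ)).toFinset z.1, z.2))) k).1 (Set.toFinite (bondsIn k (s'.Ω (k + 1))ᶜ)).toFinset z.1,
              ((baseCfg (V := FluctV N) (k + 1) ((MeasurableEquiv.piEquivPiSubtypeProd (fun _ : PBond (F.P p.K) (k + 1) => SU N)
              (· ∈ (Set.toFinite (bondsIn (k + 1) (s'.Ω (k + 1))ᶜ)).toFinset)).symm (avgRestrOfRecord F N p.K k (Set.toFinite (bondsIn k (s'.Ω (k + 1))ᶜ)).toFinset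
                (Set.toFinite (bondsIn (k + 1) (s'.Ω (k + 1))ᶜ)).toFinset z.1, z.2))) k).2))) :
    SupplyChainAt θ p :=
  ⟨σ, supplierObligations_of_bounds_of_condExp θ h p σ hloc hunivE hnewE hσ hζm hqm hbounds hce,
    noExpansionObligation_of_residualRows_of_operandRows h hU hM σ hloc hres (operandRowsAlongChain_of_supplierTermRows hσ)⟩

end Summit.QuantumFields.YangMills.Theorems.BalabanUVNodesN11SupplierObligationsOfCondExp

end
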